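import Mathlib
import Summits.KontsevichZagierPeriods.Zeta5Search.BrickPropositionHInf
import Summits.KontsevichZagierPeriods.Zeta5Search.BrickTheoremNine

/-!
# BrickTheoremTen — zi-p2's THEOREM 10 (vii)+(viii) in kernel: the OFF-DIGIT DEPTH at every level and the
supercongruence (S) `β_s(np) ≡ β_s(n) (mod p³)` for the FULL coefficient vector of the Ball/Rivoal brick linear forms
at EVERY level — i.e. for EVERY `n ≥ 1` and every prime `p ≥ 5` (T-B8.6 in full; cell zeta5-irr)

HONEST FRAMING: systematic search; no irrationality claim unless certified. INSTRUMENT theorem of the ζ(5)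
census cell zeta5-irr (HOME `run/shared/lean/pub/zeta5-irr/`; memo `zi-p2/probes/B8/thm10/THEOREM10.md` (sealed
eeb9a92811d678e0) §2 «(vii) OFF-DIGIT DEPTH at every level. For every n ≥ 1 and every s: v(OFF^{(s)}) ≥ A … (viii) THE
SUPERCONGRUENCE FOR ALL n (T-B8.6). β_s(np) ≡ β_s(n) (mod p³) for every n ≥ 1, every p ≥ 5 and every s ∈ {0,1,…,A} …
In particular for (A,B) = (4,1) [Ball's form of Apéry's ζ(3) numbers], (6,1), (6,2) [the Rivoal/Ball ζ(5)-type kernels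
of this cell]»). In the β-free NOMINAL-LEVEL form of `BrickTheoremEight`/`BrickTheoremNine` (`n < p^{L+1}` for SOME
`L`, which every `n` satisfies; `x_s(n) = Σ_K c_{K,s}(n)`, `β_s(n) = p^{L(n)τ_s}x_s(n)`, `τ_s = A − 1 − s`): THEOREM 9's
hypothesis `L ≤ A` is REMOVED. WHAT THIS IS NOT: not an irrationality statement; nothing about ζ(5); no denominator
saving; 0 nats/n; rung F-Z1 NOT moved. It is the p-adic STRUCTURE of the coefficient vectors at every depth. Filed by
the engine seat zi-eng (g10); inputs `BrickPropositionHInf` (H^∞, DIGIT THEOREM 10), `BrickHatWeight` (`g₀` admissible),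
`BrickHatReduction.hat_block_main{,_zero}` (LEMMA 9.4), `BrickTheoremNine.sum_offDigit_eq`, `BrickTheoremEight` shapes.

## The statements (`p ≥ 5` prime, `A` even, `1 ≤ B`, `2B ≤ A`; EVERY `L`)

* `weighted_inf`, `sum_digitD_inf` (digit side at every level, cells and harmonic cell as conjunctions),
  `propositionH_hatG_inf`, **`offDigit_inf`** (THEOREM 10 (vii)), `offDigit_three_inf`;
* **`theoremTen`** (THEOREM 10 (viii)): for `3 ≤ A`, EVERY `L`, `n < p^{L+1}`: every cell `s + 1 ≤ A` has
  `v(p^{(L+1)τ_s}x_s(np) − p^{Lτ_s}x_s(n)) ≤ exp(−3)`, and the same for `x_0` — `(S) mod p³` for all `n`;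
  **`theoremTen_all`**: the same for every `n` with `L = n` (no hypothesis on `n`).
-/

namespace Summit.KontsevichZagierPeriods.Zeta5Search.BrickTheoremTen

open Finset Nat WithZero
open Summit.KontsevichZagierPeriods.Zeta5Search.BrickLaurent (laurent cell phiCoeff)
open Summit.KontsevichZagierPeriods.Zeta5Search.BrickPartialFractions (cellZero xCoeff xZero)
open Summit.KontsevichZagierPeriods.Zeta5Search.BrickTopKummer (cell_one_valuation_abs)
open Summit.KontsevichZagierPeriods.Zeta5Search.BrickHoleCells (pow_mul_cellZero_valuation)
open Summit.KontsevichZagierPeriods.Zeta5Search.BrickDigitStepD (digitD digitD_sub_le)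
open Summit.KontsevichZagierPeriods.Zeta5Search.BrickDigitStepDZero (digitDZero digitDZero_sub_le)
open Summit.KontsevichZagierPeriods.Zeta5Search.BrickTheoremSixS (sum_filter_dvd_eq)
open Summit.KontsevichZagierPeriods.Zeta5Search.BrickWeightLocality (phiWeight padicValuation_phiWeight_le)
open Summit.KontsevichZagierPeriods.Zeta5Search.BrickHatWeight (hatG hatG_le_one hatG_reflect_add hatG_local)
open Summit.KontsevichZagierPeriods.Zeta5Search.BrickHatReduction (hat_block_main hat_block_main_zero)
open Summit.KontsevichZagierPeriods.Zeta5Search.BrickTheoremNine (sum_offDigit_eq)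
open Summit.KontsevichZagierPeriods.Zeta5Search.BrickPropositionHInf (propositionH_inf digitTheorem_inf)

noncomputable section

variable {p : ℕ} [Fact p.Prime]

/-! ## The digit side at every level -/

section digit

variable (h3 : 3 < p) {A B : ℕ} (hA : Even A) (hB : 1 ≤ B) (hAB : 2 * B ≤ A)
include h3 hA hB hAB

/-- DIGIT THEOREM 10 at the nominal level `L` (EVERY `L`; `n < p^{L+1}`; level `0` is plain integrality): the harmonic cell
`v(Σ_{j≤n} u_n(j)·p^{LA}cell^{(0)}_j(n)) ≤ exp(−L)` and the cells `v(Σ_{j≤n} u_n(j)·p^{L(A−s)}c_{j,s}(n)) ≤ exp(−L)`. -/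
theorem weighted_inf {L n : ℕ} (hn : n < p ^ (L + 1)) :
    Rat.padicValuation p (∑ j ∈ range (n + 1),
        phiWeight A B p n j * ((p : ℚ) ^ (L * A) * cellZero A B 1 n j)) ≤ exp (-(L : ℤ)) ∧
      ∀ s, Rat.padicValuation p (∑ j ∈ range (n + 1),
        phiWeight A B p n j * ((p : ℚ) ^ (L * (A - s)) * cell A B 1 n j s)) ≤ exp (-(L : ℤ)) := by
  have hp2 : p ≠ 2 := by omega
  rcases L with _ | L
  · refine ⟨?_, fun s => ?_⟩
    · simp only [Nat.cast_zero, neg_zero, exp_zero, zero_mul]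
      refine Valuation.map_sum_le _ fun j hj => ?_
      have hj' : j ≤ n := by have := mem_range.1 hj; omega
      rw [map_mul]
      refine mul_le_one' (padicValuation_phiWeight_le h3 hAB n j) ?_
      refine (pow_mul_cellZero_valuation hp2 hAB (L := 0) hn hj' 0).trans (exp_le_exp.2 ?_)
      simp only [Nat.cast_zero, zero_mul, Nat.cast_mul]
      nlinarith [Int.natCast_nonneg A, Int.natCast_nonneg (padicValNat p (n.choose j))]
    · simp only [Nat.cast_zero, neg_zero, exp_zero, zero_mul, pow_zero, one_mul]
      refine Valuation.map_sum_le _ fun j hj => ?_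
      have hj' : j ≤ n := by have := mem_range.1 hj; omega
      rw [map_mul]
      refine mul_le_one' (padicValuation_phiWeight_le h3 hAB n j) ?_
      have h := cell_one_valuation_abs hp2 hAB (L := 0) hn hj' s
      rwa [Nat.cast_zero, zero_mul, exp_zero] at h
  · have h := digitTheorem_inf h3 hA hB hAB hn
    exact ⟨by exact_mod_cast h.1, fun s => by exact_mod_cast h.2 s⟩

/-- **`Σ_{j≤n} D_j^{(s),L} ≡ 0 (mod p³)` at EVERY level** (`n < p^{L+1}`): the cells `s + 1 ≤ A` and the harmonic cell
(`1 ≤ A`) — COROLLARY 5 + DIGIT THEOREM 10. -/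
theorem sum_digitD_inf {L n : ℕ} (hn : n < p ^ (L + 1)) (hA1 : 1 ≤ A) :
    (∀ s, s + 1 ≤ A → Rat.padicValuation p (∑ j ∈ range (n + 1), digitD A B p L n j s) ≤ exp (-3)) ∧
      Rat.padicValuation p (∑ j ∈ range (n + 1), digitDZero A B p L n j) ≤ exp (-3) := by
  have hp : p.Prime := Fact.out
  have hpQ : (p : ℚ) ≠ 0 := by exact_mod_cast hp.ne_zero
  obtain ⟨hw0, hwS⟩ := weighted_inf h3 hA hB hAB hn
  refine ⟨fun s hs => ?_, ?_⟩
  · have hsplit : ∑ j ∈ range (n + 1), digitD A B p L n j s =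
        ∑ j ∈ range (n + 1), (digitD A B p L n j s -
          (p : ℚ) ^ (L * (A - 1 - s)) * (phiCoeff A B p n j 0 - 1) * cell A B 1 n j s) +
        (p : ℚ) ^ 3 / (p : ℚ) ^ L * ∑ j ∈ range (n + 1),
          phiWeight A B p n j * ((p : ℚ) ^ (L * (A - s)) * cell A B 1 n j s) := by
      rw [Finset.mul_sum, ← Finset.sum_add_distrib]
      refine Finset.sum_congr rfl fun j _ => ?_
      rw [phiWeight, show L * (A - s) = L * (A - 1 - s) + L by rw [← Nat.mul_succ]; congr 1; omega, pow_add]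
      field_simp
      ring
    rw [hsplit]
    refine Valuation.map_add_le _ (Valuation.map_sum_le _ fun j hj => ?_) ?_
    · exact digitD_sub_le h3 hAB hn (by have := mem_range.1 hj; omega) hs
    · rw [map_mul, map_div₀, map_pow, map_pow, Rat.padicValuation_self, ← exp_nsmul, ← exp_nsmul, ← exp_sub]
      calc _ ≤ exp ((3 : ℕ) • (-1 : ℤ) - (L : ℕ) • (-1 : ℤ)) * exp (-(L : ℤ)) := mul_le_mul' le_rfl (hwS s)
        _ = exp (-3) := by rw [← exp_add]; congr 1; simp only [nsmul_eq_mul]; ring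
  · have hsplit : ∑ j ∈ range (n + 1), digitDZero A B p L n j =
        ∑ j ∈ range (n + 1), (digitDZero A B p L n j -
          (p : ℚ) ^ (L * (A - 1)) * (phiCoeff A B p n j 0 - 1) * cellZero A B 1 n j) +
        (p : ℚ) ^ 3 / (p : ℚ) ^ L * ∑ j ∈ range (n + 1),
          phiWeight A B p n j * ((p : ℚ) ^ (L * A) * cellZero A B 1 n j) := by
      rw [Finset.mul_sum, ← Finset.sum_add_distrib]
      refine Finset.sum_congr rfl fun j _ => ?_
      rw [phiWeight, show L * A = L * (A - 1) + L by rw [← Nat.mul_succ]; congr 1; omega, pow_add]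
      field_simp
      ring
    rw [hsplit]
    refine Valuation.map_add_le _ (Valuation.map_sum_le _ fun j hj => ?_) ?_
    · exact digitDZero_sub_le h3 hAB hA1 hn (by have := mem_range.1 hj; omega)
    · rw [map_mul, map_div₀, map_pow, map_pow, Rat.padicValuation_self, ← exp_nsmul, ← exp_nsmul, ← exp_sub]
      calc _ ≤ exp ((3 : ℕ) • (-1 : ℤ) - (L : ℕ) • (-1 : ℤ)) * exp (-(L : ℤ)) := mul_le_mul' le_rfl hw0
        _ = exp (-3) := by rw [← exp_add]; congr 1; simp only [nsmul_eq_mul]; ring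

end digit

/-! ## The off-digit side at every level -/

section offDigit

variable (hp2 : p ≠ 2) {A B : ℕ} (hA : Even A) (hB : 1 ≤ B) (hAB : 2 * B ≤ A) {L m : ℕ} (hm : m < p ^ (L + 1))
include hp2 hA hB hAB hm

/-- PROPOSITION H^∞ for the hat weight `g₀` of THEOREM 9 on the row `m`, at EVERY level (harmonic cell, then cells). -/
theorem propositionH_hatG_inf :
    Rat.padicValuation p (∑ k ∈ range (m + 1), hatG A B p m k * ((p : ℚ) ^ (L * A) * cellZero A B 0 m k)) ≤
        exp (-(L : ℤ)) ∧
      ∀ s, Rat.padicValuation p (∑ k ∈ range (m + 1),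
        hatG A B p m k * ((p : ℚ) ^ (L * (A - s)) * cell A B 0 m k s)) ≤ exp (-(L : ℤ)) := by
  have h := propositionH_inf hp2 hA hB hAB L m hm (hatG A B p m) (fun _ hk => hatG_le_one hp2 hA hAB hk)
    (fun k hk => by rw [hatG_reflect_add hA B hk, map_zero]; exact _root_.zero_le)
    (fun _ _ _ he _ hk hk' hdvd => hatG_local hp2 hA hAB he hk hk' hdvd)
  exact ⟨h.2, h.1⟩

/-- **THEOREM 10 (vii), OFF-DIGIT DEPTH at EVERY level**: for the row `np`, `n = m + 1`, `m < p^{L+1}`: the harmonic cell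
and every cell `s` satisfy `v(Σ_{K≤np, p∤K} p^{(L+1)(A−s)}·c_{K,s}(np)) ≤ exp(−(A+L+1))` (THEOREM 9 (iv), `L ≤ A` removed). -/
theorem offDigit_inf :
    Rat.padicValuation p (∑ K ∈ (range ((m + 1) * p + 1)).filter (fun K => ¬ p ∣ K),
        (p : ℚ) ^ ((L + 1) * A) * cellZero A B 1 ((m + 1) * p) K) ≤ exp (-((A : ℤ) + L + 1)) ∧
      ∀ s, Rat.padicValuation p (∑ K ∈ (range ((m + 1) * p + 1)).filter (fun K => ¬ p ∣ K),
        (p : ℚ) ^ ((L + 1) * (A - s)) * cell A B 1 ((m + 1) * p) K s) ≤ exp (-((A : ℤ) + L + 1)) := by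
  have hp : p.Prime := Fact.out
  obtain ⟨hmain0, hmain⟩ := propositionH_hatG_inf hp2 hA hB hAB hm
  refine ⟨?_, fun s => ?_⟩
  · rw [sum_offDigit_eq]
    rw [show ∑ j ∈ range (m + 1), ∑ t ∈ range (p - 1), (p : ℚ) ^ ((L + 1) * A) * cellZero A B 1 ((m + 1) * p) (t + 1 + j * p)
        = ∑ j ∈ range (m + 1), (∑ t ∈ range (p - 1), (p : ℚ) ^ ((L + 1) * A) * cellZero A B 1 ((m + 1) * p) (t + 1 + j * p) -
            (p : ℚ) ^ (A + 1) * hatG A B p m j * ((p : ℚ) ^ (L * A) * cellZero A B 0 m j)) +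
          (p : ℚ) ^ (A + 1) * ∑ j ∈ range (m + 1), hatG A B p m j * ((p : ℚ) ^ (L * A) * cellZero A B 0 m j) by
        rw [Finset.mul_sum, ← Finset.sum_add_distrib]
        refine Finset.sum_congr rfl fun j _ => ?_
        ring]
    refine (Valuation.map_add _ _ _).trans (max_le (Valuation.map_sum_le _ fun j hj => ?_) ?_)
    · exact hat_block_main_zero hp2 hA hAB hm (by have := mem_range.1 hj; omega)
    · rw [map_mul, map_pow, Rat.padicValuation_self, ← exp_nsmul]
      calc _ ≤ exp ((A + 1) • (-1 : ℤ)) * exp (-(L : ℤ)) := mul_le_mul' le_rfl hmain0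
        _ = _ := by rw [← exp_add]; congr 1; simp only [nsmul_eq_mul]; push_cast; ring
  · rw [sum_offDigit_eq]
    rw [show ∑ j ∈ range (m + 1), ∑ t ∈ range (p - 1), (p : ℚ) ^ ((L + 1) * (A - s)) * cell A B 1 ((m + 1) * p) (t + 1 + j * p) s
        = ∑ j ∈ range (m + 1), (∑ t ∈ range (p - 1), (p : ℚ) ^ ((L + 1) * (A - s)) *
            laurent A B 1 ((m + 1) * p) (t + 1 + j * p) (A - s) -
            (p : ℚ) ^ (A + 1) * hatG A B p m j * ((p : ℚ) ^ (L * (A - s)) * laurent A B 0 m j (A - s))) +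
          (p : ℚ) ^ (A + 1) * ∑ j ∈ range (m + 1), hatG A B p m j * ((p : ℚ) ^ (L * (A - s)) * cell A B 0 m j s) by
        rw [Finset.mul_sum, ← Finset.sum_add_distrib]
        refine Finset.sum_congr rfl fun j _ => ?_
        simp only [cell]
        ring]
    refine (Valuation.map_add _ _ _).trans (max_le (Valuation.map_sum_le _ fun j hj => ?_) ?_)
    · exact hat_block_main hp2 hA hAB hm (by have := mem_range.1 hj; omega) (A - s)
    · rw [map_mul, map_pow, Rat.padicValuation_self, ← exp_nsmul]
      calc _ ≤ exp ((A + 1) • (-1 : ℤ)) * exp (-(L : ℤ)) := mul_le_mul' le_rfl (hmain s)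
        _ = _ := by rw [← exp_add]; congr 1; simp only [nsmul_eq_mul]; push_cast; ring

end offDigit

/-! ## THEOREM 10 (viii): (S) mod p³ for all n -/

section congruence

variable (h3 : 3 < p) {A B : ℕ} (hA : Even A) (hB : 1 ≤ B) (hAB : 2 * B ≤ A) (hA3 : 3 ≤ A)
include h3 hA hB hAB hA3

/-- The off-digit halves of `β_s(np) − β_s(n)` and of `β_0(np) − β_0(n)` are `≡ 0 (mod p³)` at EVERY level
(`n < p^{L+1}`, `A ≥ 3`): cells `s + 1 ≤ A`, then the harmonic cell. -/
theorem offDigit_three_inf {L n : ℕ} (hn : n < p ^ (L + 1)) :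
    (∀ s, s + 1 ≤ A → Rat.padicValuation p (∑ K ∈ (range (n * p + 1)).filter (fun K => ¬ p ∣ K),
        (p : ℚ) ^ ((L + 1) * (A - 1 - s)) * cell A B 1 (n * p) K s) ≤ exp (-3)) ∧
      Rat.padicValuation p (∑ K ∈ (range (n * p + 1)).filter (fun K => ¬ p ∣ K),
        (p : ℚ) ^ ((L + 1) * (A - 1)) * cellZero A B 1 (n * p) K) ≤ exp (-3) := by
  have hp : p.Prime := Fact.out
  have hp2 : p ≠ 2 := by omega
  have hpQ : (p : ℚ) ≠ 0 := by exact_mod_cast hp.ne_zero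
  rcases n with _ | m
  · have hempty : ∀ F : ℕ → ℚ, ∑ K ∈ (range (0 * p + 1)).filter (fun K => ¬ p ∣ K), F K = 0 := fun F =>
      Finset.sum_eq_zero fun K hK => by
        exfalso
        rw [mem_filter, mem_range] at hK
        exact hK.2 (by rw [show K = 0 by omega]; exact dvd_zero p)
    refine ⟨fun s _ => ?_, ?_⟩ <;> rw [hempty, map_zero] <;> exact _root_.zero_le
  · have hm : m < p ^ (L + 1) := by omega
    obtain ⟨hoff0, hoff⟩ := offDigit_inf hp2 hA hB hAB hm
    refine ⟨fun s hs => ?_, ?_⟩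
    · have hfac : ∀ K, (p : ℚ) ^ ((L + 1) * (A - 1 - s)) * cell A B 1 ((m + 1) * p) K s =
          ((p : ℚ) ^ (L + 1))⁻¹ * ((p : ℚ) ^ ((L + 1) * (A - s)) * cell A B 1 ((m + 1) * p) K s) := fun K => by
        rw [show (L + 1) * (A - s) = (L + 1) * (A - 1 - s) + (L + 1) by
          rw [← Nat.mul_succ]; congr 1; omega, pow_add]
        field_simp
        ring
      rw [Finset.sum_congr rfl fun K _ => hfac K, ← Finset.mul_sum, map_mul, map_inv₀, map_pow, Rat.padicValuation_self,
        ← exp_nsmul, ← exp_neg]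
      calc _ ≤ exp (-((L + 1) • (-1 : ℤ))) * exp (-((A : ℤ) + L + 1)) := mul_le_mul' le_rfl (hoff s)
        _ ≤ exp (-3) := by rw [← exp_add, exp_le_exp]; simp only [nsmul_eq_mul]; push_cast; omega
    · have hfac : ∀ K, (p : ℚ) ^ ((L + 1) * (A - 1)) * cellZero A B 1 ((m + 1) * p) K =
          ((p : ℚ) ^ (L + 1))⁻¹ * ((p : ℚ) ^ ((L + 1) * A) * cellZero A B 1 ((m + 1) * p) K) := fun K => by
        rw [show (L + 1) * A = (L + 1) * (A - 1) + (L + 1) by rw [← Nat.mul_succ]; congr 1; omega, pow_add]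
        field_simp
        ring
      rw [Finset.sum_congr rfl fun K _ => hfac K, ← Finset.mul_sum, map_mul, map_inv₀, map_pow, Rat.padicValuation_self,
        ← exp_nsmul, ← exp_neg]
      calc _ ≤ exp (-((L + 1) • (-1 : ℤ))) * exp (-((A : ℤ) + L + 1)) := mul_le_mul' le_rfl hoff0
        _ ≤ exp (-3) := by rw [← exp_add, exp_le_exp]; simp only [nsmul_eq_mul]; push_cast; omega

/-- **THEOREM 10 (viii) = T-B8.6 in full: the whole display (S) at EVERY level** (zi-p2 THEOREM 10): for `p ≥ 5`,
`A ≥ 3` even, `1 ≤ B`, `2B ≤ A`, EVERY `L` and every `n < p^{L+1}` — hence EVERY `n` —: every cell `s + 1 ≤ A` satisfies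
`v_p(p^{(L+1)τ_s}·x_s(np) − p^{Lτ_s}·x_s(n)) ≥ 3`, `τ_s = A − 1 − s`, and so does the harmonic cell (`τ_0 = A − 1`) — the
normalised Dwork congruence `β_s(np) ≡ β_s(n) (mod p³)` for ALL `n`; for `(A,B) = (4,1)` (Ball's form of Apéry's ζ(3)
numbers) and `(6,1), (6,2)` (Rivoal/Ball ζ(5)-type forms) at every `n` — supersedes `BrickTheoremNine.theoremNine`
(`L ≤ A`) and `BrickTheoremEight.theoremEight` (`L + 4 ≤ A`). -/
theorem theoremTen {L n : ℕ} (hn : n < p ^ (L + 1)) :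
    (∀ s, s + 1 ≤ A → Rat.padicValuation p ((p : ℚ) ^ ((L + 1) * (A - 1 - s)) * xCoeff A B 1 (n * p) s -
        (p : ℚ) ^ (L * (A - 1 - s)) * xCoeff A B 1 n s) ≤ exp (-3)) ∧
      Rat.padicValuation p ((p : ℚ) ^ ((L + 1) * (A - 1)) * xZero A B 1 (n * p) -
        (p : ℚ) ^ (L * (A - 1)) * xZero A B 1 n) ≤ exp (-3) := by
  obtain ⟨hdS, hdZ⟩ := sum_digitD_inf h3 hA hB hAB hn (by omega)
  obtain ⟨hoS, hoZ⟩ := offDigit_three_inf h3 hA hB hAB hA3 hn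
  refine ⟨fun s hs => ?_, ?_⟩
  · set τ := A - 1 - s with hτ
    have hsplit : (p : ℚ) ^ ((L + 1) * τ) * xCoeff A B 1 (n * p) s - (p : ℚ) ^ (L * τ) * xCoeff A B 1 n s =
        ∑ j ∈ range (n + 1), digitD A B p L n j s +
          ∑ K ∈ (range (n * p + 1)).filter (fun K => ¬ p ∣ K), (p : ℚ) ^ ((L + 1) * τ) * cell A B 1 (n * p) K s := by
      unfold xCoeff
      rw [Finset.mul_sum, Finset.mul_sum, ← sum_filter_add_sum_filter_not (range (n * p + 1)) (fun K => p ∣ K),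
        sum_filter_dvd_eq, add_sub_right_comm, ← Finset.sum_sub_distrib]
      congr 1
      refine Finset.sum_congr rfl fun j _ => ?_
      rw [digitD, hτ, add_mul, one_mul, pow_add]
      ring
    rw [hsplit]
    exact (Valuation.map_add _ _ _).trans (max_le (hdS s hs) (hoS s hs))
  · set τ := A - 1 with hτ
    have hsplit : (p : ℚ) ^ ((L + 1) * τ) * xZero A B 1 (n * p) - (p : ℚ) ^ (L * τ) * xZero A B 1 n =
        ∑ j ∈ range (n + 1), digitDZero A B p L n j +
          ∑ K ∈ (range (n * p + 1)).filter (fun K => ¬ p ∣ K), (p : ℚ) ^ ((L + 1) * τ) * cellZero A B 1 (n * p) K := by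
      unfold xZero
      rw [Finset.mul_sum, Finset.mul_sum, ← sum_filter_add_sum_filter_not (range (n * p + 1)) (fun K => p ∣ K),
        sum_filter_dvd_eq, add_sub_right_comm, ← Finset.sum_sub_distrib]
      congr 1
      refine Finset.sum_congr rfl fun j _ => ?_
      rw [digitDZero, hτ, add_mul, one_mul, pow_add]
      ring
    rw [hsplit]
    exact (Valuation.map_add _ _ _).trans (max_le hdZ hoZ)

/-- **(S) for EVERY `n`, hypothesis-free in `n`** (taking the nominal level `L = n`, as `n < p^{n+1}`):
every cell `s + 1 ≤ A` has `v_p(p^{(n+1)τ_s}x_s(np) − p^{nτ_s}x_s(n)) ≥ 3`, and the harmonic cell likewise. -/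
theorem theoremTen_all (n : ℕ) :
    (∀ s, s + 1 ≤ A → Rat.padicValuation p ((p : ℚ) ^ ((n + 1) * (A - 1 - s)) * xCoeff A B 1 (n * p) s -
        (p : ℚ) ^ (n * (A - 1 - s)) * xCoeff A B 1 n s) ≤ exp (-3)) ∧
      Rat.padicValuation p ((p : ℚ) ^ ((n + 1) * (A - 1)) * xZero A B 1 (n * p) -
        (p : ℚ) ^ (n * (A - 1)) * xZero A B 1 n) ≤ exp (-3) := by
  have hp : p.Prime := Fact.out
  have hn : n < p ^ (n + 1) := by
    calc n < 2 ^ n := Nat.lt_two_pow_self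
      _ ≤ p ^ n := Nat.pow_le_pow_left hp.two_le n
      _ ≤ p ^ (n + 1) := Nat.pow_le_pow_right hp.pos (by omega)
  exact theoremTen h3 hA hB hAB hA3 hn

end congruence

end

end Summit.KontsevichZagierPeriods.Zeta5Search.BrickTheoremTen
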